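import Mathlib
import Literature.Analysis.FluidPDE.NormalisedPressureL2Bound
import Literature.Analysis.FluidPDE.WholeSpaceIBP
import Literature.Analysis.FluidPDE.PressureRepresentation
import HarnessLib

/-!
# Slice pressure, partition calculus (crux `FarPastLedger`, line `uloc-gronwall-transplant`)

Helper file for the lead's stub `stub_fplSlicePressure` of crux stmt-NavierStokesRegularity-14060
(`SymmetryModuliCount.FarPastLedger`). Smooth partitions `χ₁² + χ₂² = χ₃² + χ₄²` of a velocity
field `v` are compatible with the quadratic pressure objects of the tree:

* `fpl_quadField_smul` — the quadratic field `Q(v) = (v·∇)v + (div v) v` of `χ v` is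
  `χ² Q(v) + (∂ᵥχ²) v`;
* `fpl_pressureSource_add_of_sq_add_sq_eq_one` — `G[χ₁v] + G[χ₂v] = G[v]` (`G = pressureSource`,
  `= ∂ᵢ∂ⱼ(vᵢvⱼ)`) at points near which `χ₁² + χ₂² = 1`;
* `fpl_normalisedPressure_add_eq_add` — `p̃[χ₁v] + p̃[χ₂v] = p̃[χ₃v] + p̃[χ₄v]` everywhere when
  `χ₁² + χ₂² = χ₃² + χ₄²` and the four fields are smooth with compact support (the truncated
  singular integrals are linear in the tensor `v ⊗ v`).
-/

noncomputable section

open MeasureTheory Set Filter Metric Topology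
open scoped Laplacian ContDiff

set_option linter.dupNamespace false -- nested layout Summit.<S>.<Sub>, Sub = S (D-0017)

namespace Summit.NavierStokesRegularity.NavierStokesRegularity.Theorems

open Literature.Analysis.FluidPDE

/-! ### The quadratic field of `χ v` -/

/-- `fderiv (χ²) x w = 2 χ(x) · Dχ(x) w`. -/
theorem fpl_fderiv_sq_apply {χ : (EuclideanSpace ℝ (Fin 3)) → ℝ} {x : (EuclideanSpace ℝ (Fin 3))} (hχ : DifferentiableAt ℝ χ x) (w : (EuclideanSpace ℝ (Fin 3))) :
    fderiv ℝ (fun y => χ y ^ 2) x w = 2 * χ x * fderiv ℝ χ x w := by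
  have h : HasFDerivAt (fun y => χ y ^ 2) ((2 * χ x) • fderiv ℝ χ x) x := by
    have := hχ.hasFDerivAt.pow 2
    simpa using this
  rw [h.fderiv]
  simp [mul_assoc]

/-- **The quadratic field of `χ v`**: with `Q(v) := (v·∇)v + (div v) v`,
`Q(χ v) = χ² Q(v) + (D(χ²)[v]) v` at points of differentiability. -/
theorem fpl_quadField_smul {χ : (EuclideanSpace ℝ (Fin 3)) → ℝ} {v : (EuclideanSpace ℝ (Fin 3)) → (EuclideanSpace ℝ (Fin 3))} {x : (EuclideanSpace ℝ (Fin 3))} (hχ : DifferentiableAt ℝ χ x)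
    (hv : DifferentiableAt ℝ v x) :
    convect (fun y => χ y • v y) (fun y => χ y • v y) x +
        VectorCalculus.divergence (fun y => χ y • v y) x • (χ x • v x) =
      (χ x ^ 2) • (convect v v x + VectorCalculus.divergence v x • v x) +
        (fderiv ℝ (fun y => χ y ^ 2) x (v x)) • v x := by
  rw [convect_smul_apply hχ hv, divergence_smul_apply hχ hv, fpl_fderiv_sq_apply hχ]
  have hg : inner ℝ (v x) (gradient χ x) = fderiv ℝ χ x (v x) := by
    rw [real_inner_comm, gradient, InnerProductSpace.toDual_symm_apply]
  rw [hg]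
  simp only [convect, map_smul, smul_smul, smul_add, pow_two]
  module

/-! ### The quadratic source of a partition -/

/-- **`G[χ₁v] + G[χ₂v] = G[v]` near points where `χ₁² + χ₂² = 1`** (`G = pressureSource`). -/
theorem fpl_pressureSource_add_of_sq_add_sq_eq_one {χ₁ χ₂ : (EuclideanSpace ℝ (Fin 3)) → ℝ} {v : (EuclideanSpace ℝ (Fin 3)) → (EuclideanSpace ℝ (Fin 3))}
    (hχ₁ : ContDiff ℝ 2 χ₁) (hχ₂ : ContDiff ℝ 2 χ₂) (hv : ContDiff ℝ 2 v) {x : (EuclideanSpace ℝ (Fin 3))}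
    (h1 : ∀ᶠ y in 𝓝 x, χ₁ y ^ 2 + χ₂ y ^ 2 = 1) :
    pressureSource (fun y => χ₁ y • v y) x + pressureSource (fun y => χ₂ y • v y) x =
      pressureSource v x := by
  -- abbreviations
  set S : (EuclideanSpace ℝ (Fin 3)) → (EuclideanSpace ℝ (Fin 3)) := fun y => convect v v y + VectorCalculus.divergence v y • v y with hS
  set R : ((EuclideanSpace ℝ (Fin 3)) → ℝ) → (EuclideanSpace ℝ (Fin 3)) → (EuclideanSpace ℝ (Fin 3)) := fun χ y =>
    (χ y ^ 2) • S y + (fderiv ℝ (fun z => χ z ^ 2) y (v y)) • v y with hR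
  have hv1 : Differentiable ℝ v := hv.differentiable (by norm_num)
  have hχd : ∀ {χ : (EuclideanSpace ℝ (Fin 3)) → ℝ}, ContDiff ℝ 2 χ → Differentiable ℝ χ := fun h =>
    h.differentiable (by norm_num)
  -- the quadratic fields of `χᵢ v` as functions
  have hQ : ∀ {χ : (EuclideanSpace ℝ (Fin 3)) → ℝ}, ContDiff ℝ 2 χ →
      (fun y => convect (fun z => χ z • v z) (fun z => χ z • v z) y +
        VectorCalculus.divergence (fun z => χ z • v z) y • (χ y • v y)) = R χ := by
    intro χ hχ
    funext y
    exact fpl_quadField_smul (hχd hχ y) (hv1 y)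
  -- differentiability of `S` and of the `R χ`
  have hS1 : ContDiff ℝ 1 S := by
    have hv' : ContDiff ℝ ((1 : ℕ∞) + 1) v := by exact_mod_cast hv
    exact (contDiff_convect_self hv').add ((contDiff_divergence hv').smul
      (hv'.of_le le_self_add))
  have hR1 : ∀ {χ : (EuclideanSpace ℝ (Fin 3)) → ℝ}, ContDiff ℝ 2 χ → Differentiable ℝ (R χ) := by
    intro χ hχ
    have hsq : ContDiff ℝ 2 (fun z => χ z ^ 2) := hχ.pow 2
    have hD : ContDiff ℝ 1 (fun y => fderiv ℝ (fun z => χ z ^ 2) y (v y)) :=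
      (hsq.fderiv_right (m := 1) le_rfl).clm_apply (hv.of_le (by norm_num))
    have h : ContDiff ℝ 1 (R χ) :=
      ((hsq.of_le (by norm_num)).smul hS1).add (hD.smul (hv.of_le (by norm_num)))
    exact h.differentiable one_ne_zero
  -- rewrite both sources as divergences of the `R χᵢ`
  have e1 : pressureSource (fun y => χ₁ y • v y) x = VectorCalculus.divergence (R χ₁) x := by
    rw [pressureSource_def]
    exact congrArg (fun f => VectorCalculus.divergence f x) (by
      have := hQ hχ₁; simpa only [Pi.smul_apply] using this)
  have e2 : pressureSource (fun y => χ₂ y • v y) x = VectorCalculus.divergence (R χ₂) x := by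
    rw [pressureSource_def]
    exact congrArg (fun f => VectorCalculus.divergence f x) (by
      have := hQ hχ₂; simpa only [Pi.smul_apply] using this)
  rw [e1, e2, ← divergence_add_apply (hR1 hχ₁ x) (hR1 hχ₂ x)]
  -- near `x` the sum of the `R χᵢ` is `S`
  have hsum : (fun y => R χ₁ y + R χ₂ y) =ᶠ[𝓝 x] S := by
    -- `χ₁² + χ₂²` is locally `1`, hence its derivative vanishes near `x`
    have hloc : ∀ᶠ y in 𝓝 x, fderiv ℝ (fun z => χ₁ z ^ 2 + χ₂ z ^ 2) y = 0 := by
      have hopen := eventually_eventually_nhds.2 h1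
      filter_upwards [hopen] with y hy
      have : (fun z => χ₁ z ^ 2 + χ₂ z ^ 2) =ᶠ[𝓝 y] fun _ => (1 : ℝ) := hy
      rw [this.fderiv_eq]
      simp
    filter_upwards [h1, hloc] with y hy hDy
    have hd1 : DifferentiableAt ℝ (fun z => χ₁ z ^ 2) y := ((hχd hχ₁).pow 2) y
    have hd2 : DifferentiableAt ℝ (fun z => χ₂ z ^ 2) y := ((hχd hχ₂).pow 2) y
    have hDsum : fderiv ℝ (fun z => χ₁ z ^ 2) y (v y) + fderiv ℝ (fun z => χ₂ z ^ 2) y (v y) = 0 := by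
      have := congrArg (fun L : (EuclideanSpace ℝ (Fin 3)) →L[ℝ] ℝ => L (v y)) hDy
      simp only [zero_apply] at this
      rw [fderiv_fun_add hd1 hd2] at this
      simpa using this
    simp only [hR]
    calc (χ₁ y ^ 2) • S y + (fderiv ℝ (fun z => χ₁ z ^ 2) y (v y)) • v y +
          ((χ₂ y ^ 2) • S y + (fderiv ℝ (fun z => χ₂ z ^ 2) y (v y)) • v y)
        = (χ₁ y ^ 2 + χ₂ y ^ 2) • S y +
            (fderiv ℝ (fun z => χ₁ z ^ 2) y (v y) + fderiv ℝ (fun z => χ₂ z ^ 2) y (v y)) • v y := by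
          rw [add_smul, add_smul]; abel
      _ = S y := by rw [hy, hDsum, one_smul, zero_smul, add_zero]
  have hfd : fderiv ℝ (fun y => R χ₁ y + R χ₂ y) x = fderiv ℝ S x := hsum.fderiv_eq
  rw [pressureSource_def]
  show VectorCalculus.divergence (fun y => R χ₁ y + R χ₂ y) x = VectorCalculus.divergence S x
  simp only [VectorCalculus.divergence, hfd]

/-! ### Additivity of the normalised pressure over tensor-compatible partitions -/

/-- The truncated pressure integrand of `χ v` is `χ²` times that of `v`. -/
theorem fpl_pressureKernel_smul_field (χ : (EuclideanSpace ℝ (Fin 3)) → ℝ) (v : (EuclideanSpace ℝ (Fin 3)) → (EuclideanSpace ℝ (Fin 3))) (x y : (EuclideanSpace ℝ (Fin 3))) :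
    pressureKernel (x - y) ((fun z => χ z • v z) y) = χ y ^ 2 * pressureKernel (x - y) (v y) :=
  pressureKernel_smul_right _ _ _

/-- **`p̃[χ₁v] + p̃[χ₂v] = p̃[χ₃v] + p̃[χ₄v]`** at every point, for smooth compactly supported fields
`χᵢ v` with `χ₁² + χ₂² = χ₃² + χ₄²`: the local terms `-|χᵢv|²/3` and the truncated singular
integrals `∫_{|x-y|>ε} χᵢ(y)² K(x-y)(v y) dy` both add up through `χ₁² + χ₂² = χ₃² + χ₄²`, and
principal values are limits. -/
theorem fpl_normalisedPressure_add_eq_add {χ₁ χ₂ χ₃ χ₄ : (EuclideanSpace ℝ (Fin 3)) → ℝ} {v : (EuclideanSpace ℝ (Fin 3)) → (EuclideanSpace ℝ (Fin 3))}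
    (h₁ : ContDiff ℝ ∞ fun y => χ₁ y • v y) (h₂ : ContDiff ℝ ∞ fun y => χ₂ y • v y)
    (h₃ : ContDiff ℝ ∞ fun y => χ₃ y • v y) (h₄ : ContDiff ℝ ∞ fun y => χ₄ y • v y)
    (c₁ : HasCompactSupport fun y => χ₁ y • v y) (c₂ : HasCompactSupport fun y => χ₂ y • v y)
    (c₃ : HasCompactSupport fun y => χ₃ y • v y) (c₄ : HasCompactSupport fun y => χ₄ y • v y)
    (h : ∀ y, χ₁ y ^ 2 + χ₂ y ^ 2 = χ₃ y ^ 2 + χ₄ y ^ 2) (x : (EuclideanSpace ℝ (Fin 3))) :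
    normalisedPressure (fun y => χ₁ y • v y) x + normalisedPressure (fun y => χ₂ y • v y) x =
      normalisedPressure (fun y => χ₃ y • v y) x + normalisedPressure (fun y => χ₄ y • v y) x := by
  obtain ⟨P₁⟩ : Nonempty (∃ L, HasPressurePV (fun y => χ₁ y • v y) x L) :=
    ⟨⟨_, hasPressurePV_of_hasCompactSupport h₁ c₁ x⟩⟩
  obtain ⟨L₁, hL₁⟩ := P₁
  obtain ⟨L₂, hL₂⟩ : ∃ L, HasPressurePV (fun y => χ₂ y • v y) x L :=
    ⟨_, hasPressurePV_of_hasCompactSupport h₂ c₂ x⟩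
  obtain ⟨L₃, hL₃⟩ : ∃ L, HasPressurePV (fun y => χ₃ y • v y) x L :=
    ⟨_, hasPressurePV_of_hasCompactSupport h₃ c₃ x⟩
  obtain ⟨L₄, hL₄⟩ : ∃ L, HasPressurePV (fun y => χ₄ y • v y) x L :=
    ⟨_, hasPressurePV_of_hasCompactSupport h₄ c₄ x⟩
  rw [normalisedPressure_eq hL₁, normalisedPressure_eq hL₂, normalisedPressure_eq hL₃,
    normalisedPressure_eq hL₄]
  -- the local terms
  have hloc : ‖χ₁ x • v x‖ ^ 2 + ‖χ₂ x • v x‖ ^ 2 = ‖χ₃ x • v x‖ ^ 2 + ‖χ₄ x • v x‖ ^ 2 := by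
    simp only [norm_smul, mul_pow, Real.norm_eq_abs, sq_abs]
    rw [← add_mul, ← add_mul, h x]
  -- the principal values
  have hT : ∀ᶠ ε in 𝓝[>] (0 : ℝ),
      truncatedPressureIntegral (fun y => χ₁ y • v y) x ε +
          truncatedPressureIntegral (fun y => χ₂ y • v y) x ε =
        truncatedPressureIntegral (fun y => χ₃ y • v y) x ε +
          truncatedPressureIntegral (fun y => χ₄ y • v y) x ε := by
    filter_upwards [hL₁.1, hL₂.1, hL₃.1, hL₄.1] with ε i₁ i₂ i₃ i₄
    simp only [truncatedPressureIntegral]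
    rw [← integral_add i₁ i₂, ← integral_add i₃ i₄]
    refine integral_congr_ae (Eventually.of_forall fun y => ?_)
    simp only [fpl_pressureKernel_smul_field]
    rw [← add_mul, ← add_mul, h y]
  have hlim₁₂ : Tendsto (fun ε => truncatedPressureIntegral (fun y => χ₁ y • v y) x ε +
      truncatedPressureIntegral (fun y => χ₂ y • v y) x ε) (𝓝[>] 0) (𝓝 (L₁ + L₂)) :=
    hL₁.2.add hL₂.2
  have hlim₃₄ : Tendsto (fun ε => truncatedPressureIntegral (fun y => χ₃ y • v y) x ε +
      truncatedPressureIntegral (fun y => χ₄ y • v y) x ε) (𝓝[>] 0) (𝓝 (L₃ + L₄)) :=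
    hL₃.2.add hL₄.2
  have hPV : L₁ + L₂ = L₃ + L₄ := tendsto_nhds_unique (hlim₁₂.congr' hT) hlim₃₄
  have e : -‖χ₁ x • v x‖ ^ 2 / (Module.finrank ℝ (EuclideanSpace ℝ (Fin 3)) : ℝ) + L₁ +
      (-‖χ₂ x • v x‖ ^ 2 / (Module.finrank ℝ (EuclideanSpace ℝ (Fin 3)) : ℝ) + L₂) =
      -(‖χ₁ x • v x‖ ^ 2 + ‖χ₂ x • v x‖ ^ 2) / (Module.finrank ℝ (EuclideanSpace ℝ (Fin 3)) : ℝ) + (L₁ + L₂) := by ring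
  have e' : -‖χ₃ x • v x‖ ^ 2 / (Module.finrank ℝ (EuclideanSpace ℝ (Fin 3)) : ℝ) + L₃ +
      (-‖χ₄ x • v x‖ ^ 2 / (Module.finrank ℝ (EuclideanSpace ℝ (Fin 3)) : ℝ) + L₄) =
      -(‖χ₃ x • v x‖ ^ 2 + ‖χ₄ x • v x‖ ^ 2) / (Module.finrank ℝ (EuclideanSpace ℝ (Fin 3)) : ℝ) + (L₃ + L₄) := by ring
  rw [e, e', hloc, hPV]

/-- Registered form (sub-goal `fpl_sliceSource_main` of crux stmt-NavierStokesRegularity-14060):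
`p̃[χ₁v] + p̃[χ₂v] = p̃[χ₃v] + p̃[χ₄v]` under `χ₁² + χ₂² = χ₃² + χ₄²`. -/
theorem fpl_sliceSource_main :
    ∀ (χ₁ χ₂ χ₃ χ₄ : EuclideanSpace ℝ (Fin 3) → ℝ)
      (v : EuclideanSpace ℝ (Fin 3) → EuclideanSpace ℝ (Fin 3)),
    ContDiff ℝ (⊤ : ℕ∞) (fun y => χ₁ y • v y) → ContDiff ℝ (⊤ : ℕ∞) (fun y => χ₂ y • v y) →
    ContDiff ℝ (⊤ : ℕ∞) (fun y => χ₃ y • v y) → ContDiff ℝ (⊤ : ℕ∞) (fun y => χ₄ y • v y) →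
    HasCompactSupport (fun y => χ₁ y • v y) → HasCompactSupport (fun y => χ₂ y • v y) →
    HasCompactSupport (fun y => χ₃ y • v y) → HasCompactSupport (fun y => χ₄ y • v y) →
    (∀ y, χ₁ y ^ 2 + χ₂ y ^ 2 = χ₃ y ^ 2 + χ₄ y ^ 2) →
    ∀ x : EuclideanSpace ℝ (Fin 3),
      Literature.Analysis.FluidPDE.normalisedPressure (fun y => χ₁ y • v y) x +
          Literature.Analysis.FluidPDE.normalisedPressure (fun y => χ₂ y • v y) x =
        Literature.Analysis.FluidPDE.normalisedPressure (fun y => χ₃ y • v y) x +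
          Literature.Analysis.FluidPDE.normalisedPressure (fun y => χ₄ y • v y) x :=
  fun _ _ _ _ _ h₁ h₂ h₃ h₄ c₁ c₂ c₃ c₄ h x =>
    fpl_normalisedPressure_add_eq_add h₁ h₂ h₃ h₄ c₁ c₂ c₃ c₄ h x

end Summit.NavierStokesRegularity.NavierStokesRegularity.Theorems

end
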